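import Literature.Topology.FourManifolds.RadialLinearization
import Literature.Topology.FourManifolds.GompfStraighteningExistence
import Literature.Topology.FourManifolds.GompfConePaths
import HarnessLib

/-!
# The radial straightening of a Cappell–Shaneson monodromy: every class, with cone control

Sixth brick from this seat towards the framed form of Gompf's Theorem 2.1
(`Literature.Topology.FourManifolds.gompf2010_framedTwist`; R. Gompf, *More Cappell–Shaneson
spheres are standard*, Algebr. Geom. Topol. 10 (2010)). `GompfStraighteningExistence.lean` and
`GompfAxisTwist.lean` give, for every `A ∈ SL(3, ℤ)` and both straightening classes, *some*
`Straightening A` (products of near-identity bumps). For Theorem 2.1 one needs more (§4 ¶3):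
"the isotopy corresponding to each straightening of `A` can be chosen to keep `φ(α)` within the
torus `T`". This file realises **every framing path `β : 1 ⟿ B` itself** (up to time
reparametrisation) as the germ of a straightening given by the closed **radial** formula of
`RadialLinearization.lean`, `F_t (expT v) = expT (Q(σ(t) χ(v)) v)` with `Q(s) = β(1 - s) B⁻¹`,
whose stages map every ray `ℝ u` into the cone swept by `Q(·) u` — so that, for `β` cone-nice
(`GompfConePaths.lean`, available in every class), the straightened monodromy `ψ = B ∘ F₁` maps the
coordinate circle in direction `B u` to an explicit *radial graph* inside the flat coordinate
torus spanned by `B u` and `B² u` (`radialStraightening_monodromy_expT_smul`).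

* `Literature.Topology.FourManifolds.surjective_radialLinMap`, `radialLinDiffeo` — the stages of
  the radial linearization are diffeomorphisms of `ℝ³` (injective local diffeomorphisms with
  clopen range);
* `Literature.Topology.FourManifolds.radialDiffeotopy Q` (of `ℝ³`, `Diffeotopy.ofFamily`) and
  `Literature.Topology.FourManifolds.SmoothMatrixPath.reverseInv β : SmoothMatrixPath (B⁻¹)` —
  the path `s ↦ β(1 - s) B⁻¹`;
* **`Literature.Topology.FourManifolds.radialStraightening B β : Straightening B`** (torus level by
  `Diffeotopy.torusExtend`), with linear parts `G_t = β(1 - σ t) B⁻¹`,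
  `radialStraightening_path_toFun` and `homotopic_radialStraightening_path`:
  **`β ≃ (radialStraightening B β).path`**, hence
  `nonempty_diffeomorph_gompfSphere_radialProdSphere`:
  `gompfSphere B β ≃ₘ (radialStraightening B β).prodSphere` for *every* `β` (no class case split);
* `Literature.Topology.FourManifolds.radialStraightening_toFun_expT_smul`,
  `radialStraightening_monodromy_expT_smul` — the ray/cone property of the stages and of the
  monodromy in exponential coordinates; and the payoff
  `Literature.Topology.FourManifolds.radialStraightening_monodromy_expT_axis`: for `B` in standard
  form and `β` cone-nice for `B⁻¹ e₁`, **`ψ (expT (θ e₁)) = expT (θ (a(τ) e₁ + b(τ) e₃))`** — the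
  image of the coordinate circle `α` is a radial graph in the flat torus `T = ⟨e₁, e₃⟩`, equal
  to `α` on an initial segment of radii (Gompf's hypotheses `T ⊃ α ∪ ψ(α)`, `α ∩ ψ(α)` connected).

Everything is proved; no named facts are introduced.

## References

* R. E. Gompf, *More Cappell–Shaneson spheres are standard*, Algebr. Geom. Topol. 10 (2010)
  1665–1681: §4 Def. 4.1, ¶2 ("for any straightening σ … there is an isotopy φ_t rel p for which
  φ_1 fixes a neighborhood of p and d(φ_t)_p represents σ") and ¶3. [GompfAGT2010]
* M. W. Hirsch, *Differential Topology* (1976), Ch. 8 §1. [HirschDT1976]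
-/

noncomputable section

open scoped Manifold ContDiff Topology Real unitInterval
open Set Function Metric Filter Matrix

namespace Literature.Topology.FourManifolds

/-- Local notation: `𝔼 n` is the model Euclidean space `EuclideanSpace ℝ (Fin n)`. -/
local notation "𝔼 " n:arg => EuclideanSpace ℝ (Fin n)

/-- Local notation: the model with corners `𝓣 = (𝓡 1).prod ((𝓡 1).prod (𝓡 1))` of `ThreeTorus`. -/
local notation "𝓣" =>
  (ModelWithCorners.prod (𝓡 1) (ModelWithCorners.prod (𝓡 1) (𝓡 1)))

/-! ### The stages of the radial linearization are diffeomorphisms of `ℝ³` -/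

section Stages

variable {N : Matrix (Fin 3) (Fin 3) ℝ} (Q : SmoothMatrixPath N) {ρ L : ℝ}

/-- The radial linearization is a local diffeomorphism (globally). [folklore] -/
theorem isLocalDiffeomorph_radialLinMap (hρ : 0 < ρ) (hL : Q.radialScale ≤ L) (s : ℝ) :
    IsLocalDiffeomorph 𝓘(ℝ, 𝔼 3) 𝓘(ℝ, 𝔼 3) ∞ (radialLinMap Q ρ L s) := fun v ↦
  isLocalDiffeomorphAt_radialLinMap Q hρ hL s v

/-- **The range of a stage is closed**: it is the image of the closed ball `B̄(0, ρ e^L)` together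
with the (pointwise fixed) exterior. [folklore] -/
theorem isClosed_range_radialLinMap (hρ : 0 < ρ) (hL : Q.radialScale ≤ L) (s : ℝ) :
    IsClosed (range (radialLinMap Q ρ L s)) := by
  have hLpos : 0 < L := Q.radialScale_pos.trans_le hL
  have hcont : Continuous (radialLinMap Q ρ L s) :=
    ((contDiff_radialLinMap Q hρ hLpos).comp (contDiff_const.prodMk contDiff_id)).continuous
  have h : range (radialLinMap Q ρ L s) =
      radialLinMap Q ρ L s '' closedBall (0 : 𝔼 3) (ρ * Real.exp L) ∪
        {v : 𝔼 3 | ρ * Real.exp L ≤ ‖v‖} := by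
    apply Subset.antisymm
    · rintro _ ⟨v, rfl⟩
      by_cases hv : ‖v‖ ≤ ρ * Real.exp L
      · exact Or.inl ⟨v, mem_closedBall_zero_iff.2 hv, rfl⟩
      · right
        rw [mem_setOf_eq, radialLinMap_of_le_norm Q hρ hLpos s (not_le.1 hv).le]
        exact (not_le.1 hv).le
    · rintro w (⟨v, -, rfl⟩ | hw)
      · exact ⟨v, rfl⟩
      · exact ⟨w, radialLinMap_of_le_norm Q hρ hLpos s hw⟩
  rw [h]
  exact ((isCompact_closedBall _ _).image hcont).isClosed.union
    (isClosed_le continuous_const continuous_norm)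

/-- **The stages of the radial linearization are surjective** (the range is clopen and nonempty in
the connected `ℝ³`). [folklore] -/
theorem surjective_radialLinMap (hρ : 0 < ρ) (hL : Q.radialScale ≤ L) (s : ℝ) :
    Surjective (radialLinMap Q ρ L s) := by
  have hclopen : IsClopen (range (radialLinMap Q ρ L s)) :=
    ⟨isClosed_range_radialLinMap Q hρ hL s, (isLocalDiffeomorph_radialLinMap Q hρ hL s).isOpen_range⟩
  exact range_eq_univ.1 (hclopen.eq_univ (range_nonempty _))

/-- **The stage `Φ_s` as a diffeomorphism of `ℝ³`.** [cite: GompfAGT2010, §4 ¶2 (an isotopy rel p straightening the linear monodromy near 0)] -/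
def radialLinDiffeo (hρ : 0 < ρ) (hL : Q.radialScale ≤ L) (s : ℝ) :
    (𝔼 3) ≃ₘ⟮𝓘(ℝ, 𝔼 3), 𝓘(ℝ, 𝔼 3)⟯ 𝔼 3 :=
  (isLocalDiffeomorph_radialLinMap Q hρ hL s).diffeomorphOfBijective
    ⟨radialLinMap_injective Q hρ hL s, surjective_radialLinMap Q hρ hL s⟩

/-- The diffeomorphism is the stage as a function. [folklore] -/
@[simp] theorem coe_radialLinDiffeo (hρ : 0 < ρ) (hL : Q.radialScale ≤ L) (s : ℝ) :
    ⇑(radialLinDiffeo Q hρ hL s) = radialLinMap Q ρ L s := rfl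

/-- **The radial diffeotopy of `ℝ³`** (`Diffeotopy.ofFamily`): stages `Φ_s`, the identity for
`s ≤ 0`. [cite: GompfAGT2010, §4 ¶2 (an isotopy rel p straightening the linear monodromy near 0)] -/
def radialDiffeotopy (hρ : 0 < ρ) (hL : Q.radialScale ≤ L) : Diffeotopy 𝓘(ℝ, 𝔼 3) (𝔼 3) :=
  Diffeotopy.ofFamily (radialLinMap Q ρ L) (contDiff_radialLinMap Q hρ (Q.radialScale_pos.trans_le hL))
    (fun s ↦ ⟨radialLinDiffeo Q hρ hL s, rfl⟩) (funext (radialLinMap_of_nonpos Q le_rfl))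

/-- Stages of the radial diffeotopy (definitional). [folklore] -/
@[simp] theorem radialDiffeotopy_toFun (hρ : 0 < ρ) (hL : Q.radialScale ≤ L) (s : ℝ) :
    (radialDiffeotopy Q hρ hL).toFun s = radialLinMap Q ρ L s := rfl

end Stages

/-! ### The reversed inverse path `s ↦ β(1 - s) B⁻¹` -/

namespace SmoothMatrixPath

variable {B : Matrix.SpecialLinearGroup (Fin 3) ℤ} (β : SmoothMatrixPath (slRealMatrix B))

/-- **The path `Q(s) = β(1 - s) B⁻¹` from `1` to `B⁻¹`** (so that `Q(1 - t) B = β(t)`). [folklore] -/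
def reverseInv : SmoothMatrixPath (slRealMatrix B⁻¹) where
  toFun s := β.toFun (1 - s) * slRealMatrix B⁻¹
  inv s := slRealMatrix B * β.inv (1 - s)
  contDiff_apply := contDiff_mul_apply (fun i j ↦ (β.contDiff_apply i j).comp
    (contDiff_const.sub contDiff_id)) fun _ _ ↦ contDiff_const
  contDiff_inv_apply := contDiff_mul_apply (fun _ _ ↦ contDiff_const) fun i j ↦
    (β.contDiff_inv_apply i j).comp (contDiff_const.sub contDiff_id)
  mul_inv s := by
    rw [Matrix.mul_assoc, ← Matrix.mul_assoc (slRealMatrix B⁻¹), slRealMatrix_inv_mul, Matrix.one_mul,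
      β.mul_inv]
  inv_mul s := by
    rw [Matrix.mul_assoc, ← Matrix.mul_assoc (β.inv _), β.inv_mul, Matrix.one_mul, slRealMatrix_mul_inv]
  eq_one s hs := by rw [β.eq_self _ (by linarith), slRealMatrix_mul_inv]
  eq_self s hs := by rw [β.eq_one _ (by linarith), Matrix.one_mul]

/-- Values of `reverseInv`. [folklore] -/
@[simp] theorem reverseInv_toFun (s : ℝ) : β.reverseInv.toFun s = β.toFun (1 - s) * slRealMatrix B⁻¹ := rfl

/-- Values of the inverse of `reverseInv`. [folklore] -/
@[simp] theorem reverseInv_inv (s : ℝ) : β.reverseInv.inv s = slRealMatrix B * β.inv (1 - s) := rfl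

/-- `Q(s) B = β(1 - s)`. [folklore] -/
theorem reverseInv_toFun_mul (s : ℝ) : β.reverseInv.toFun s * slRealMatrix B = β.toFun (1 - s) := by
  rw [reverseInv_toFun, Matrix.mul_assoc, slRealMatrix_inv_mul, Matrix.mul_one]

end SmoothMatrixPath

/-! ### The radial straightening -/

section Radial

variable (B : Matrix.SpecialLinearGroup (Fin 3) ℤ) (β : SmoothMatrixPath (slRealMatrix B))

/-- The logarithmic scale `L = L₀(Q)` of the radial straightening of `β`. [folklore] -/
def radialL : ℝ := β.reverseInv.radialScale

/-- The inner radius `ρ = (π/4) e^{-L}` of the radial straightening of `β` (so that the outer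
radius `ρ e^L` is `π/4`). [folklore] -/
def radialRho : ℝ := π / 4 * Real.exp (-radialL B β)

/-- `0 < L`. [folklore] -/
theorem radialL_pos : 0 < radialL B β := β.reverseInv.radialScale_pos

/-- `0 < ρ`. [folklore] -/
theorem radialRho_pos : 0 < radialRho B β := by unfold radialRho; positivity

/-- `ρ e^L = π/4`. [folklore] -/
theorem radialRho_mul_exp : radialRho B β * Real.exp (radialL B β) = π / 4 := by
  rw [radialRho, mul_assoc, ← Real.exp_add, neg_add_cancel, Real.exp_zero, mul_one]

/-- `ρ ≤ π/4`. [folklore] -/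
theorem radialRho_le : radialRho B β ≤ π / 4 := by
  have h := radialRho_mul_exp B β
  have h1 : radialRho B β ≤ radialRho B β * Real.exp (radialL B β) :=
    le_mul_of_one_le_right (radialRho_pos B β).le (Real.one_le_exp
      (β.reverseInv.radialScale_pos).le)
  linarith

/-- The stages of the radial diffeotopy of `β` are the identity off `B(0, π/4)`. [folklore] -/
theorem radialDiffeotopy_toFun_eq_self (t : ℝ) (v : 𝔼 3) (hv : π / 4 ≤ ‖v‖) :
    (radialDiffeotopy β.reverseInv (radialRho_pos B β) (le_refl (radialL B β))).toFun t v = v := by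
  rw [radialDiffeotopy_toFun]
  exact radialLinMap_of_le_norm _ (radialRho_pos B β) (radialL_pos B β) t
    ((radialRho_mul_exp B β).trans_le hv)

/-- `π/4 < π`. [folklore] -/
theorem pi_div_four_lt_pi : π / 4 < π := by linarith [Real.pi_pos]

/-- **The radial straightening diffeotopy of `T³`** (`Diffeotopy.torusExtend` of the radial
diffeotopy of `ℝ³`). [cite: GompfAGT2010, §4 ¶2 (an isotopy rel p straightening the linear monodromy near 0)] -/
def radialTorusDiffeotopy : Diffeotopy 𝓣 ThreeTorus :=
  (radialDiffeotopy β.reverseInv (radialRho_pos B β) (le_refl (radialL B β))).torusExtend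
    pi_div_four_lt_pi (radialDiffeotopy_toFun_eq_self B β)

/-- Coordinates of a vector in the open cube of half-width `R` have norm `< 2R`; in particular
the cube of half-width `ρ/2` lies in the ball `B(0, ρ)`. [folklore] -/
theorem norm_le_of_abs_lt_half {R : ℝ} {v : 𝔼 3} (hv : ∀ i, |v i| < R / 2) : ‖v‖ ≤ R := by
  have := norm_lt_two_mul_of_abs_lt hv; linarith

/-- **The radial straightening in exponential coordinates**: on the cube `|vᵢ| < ρ/2` the stage at
time `t` is the linear map `Q(σ t) = β(1 - σ t) B⁻¹`. [cite: GompfAGT2010, Def. 4.1 and §4 ¶2] -/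
theorem radialTorusDiffeotopy_toFun_expT (t : ℝ) (v : 𝔼 3) (hv : ∀ i, |v i| < radialRho B β / 2) :
    (radialTorusDiffeotopy B β).toFun t (expT v) =
      expT (mulVecE (β.reverseInv.toFun (Real.smoothTransition t)) v) := by
  have hρ := radialRho_pos B β
  have hπ : ∀ j, |v j| < π := fun j ↦ (hv j).trans (by linarith [radialRho_le B β, Real.pi_pos])
  rw [radialTorusDiffeotopy, Diffeotopy.torusExtend_toFun_expT _ _ _ t hπ, radialDiffeotopy_toFun,
    radialLinMap_of_norm_le _ hρ (radialL_pos B β) t (norm_le_of_abs_lt_half hv)]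

/-- The radius of the cube on which both the stages and their inverses are linear:
`R = ρ / (36 K)`, `K` the entry bound of `Q`. [folklore] -/
def radialR : ℝ := radialRho B β / (36 * β.reverseInv.entryBound)

/-- `0 < R`. [folklore] -/
theorem radialR_pos : 0 < radialR B β :=
  div_pos (radialRho_pos B β) (mul_pos (by norm_num) β.reverseInv.entryBound_pos)

/-- `R ≤ ρ / 2` (as `K ≥ 1`). [folklore] -/
theorem radialR_le : radialR B β ≤ radialRho B β / 2 := by
  unfold radialR
  have hK := β.reverseInv.one_le_entryBound
  have hρ := radialRho_pos B β
  rw [div_le_div_iff₀ (by positivity) two_pos]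
  nlinarith

/-- On the smaller cube `|vᵢ| < R` the vector `Q⁻¹ v` lies in the cube `|wᵢ| < ρ/2`. [folklore] -/
theorem abs_mulVecE_inv_lt (s : ℝ) (v : 𝔼 3) (hv : ∀ i, |v i| < radialR B β) (i : Fin 3) :
    |mulVecE (β.reverseInv.inv s) v i| < radialRho B β / 2 := by
  have hK := β.reverseInv.entryBound_pos
  have hρ := radialRho_pos B β
  have h1 := abs_mulVecE_apply_le (m := 3) (fun i j ↦ β.reverseInv.abs_inv_le s i j) v i
  have h2 : ‖v‖ < 2 * radialR B β := norm_lt_two_mul_of_abs_lt hv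
  have h3 : (3 : ℝ) * β.reverseInv.entryBound * ‖v‖ < 3 * β.reverseInv.entryBound * (2 * radialR B β) :=
    mul_lt_mul_of_pos_left h2 (by positivity)
  have h4 : 3 * β.reverseInv.entryBound * (2 * radialR B β) = radialRho B β / 6 := by
    unfold radialR; field_simp; ring
  have : (3 : ℕ) * β.reverseInv.entryBound * ‖v‖ = 3 * β.reverseInv.entryBound * ‖v‖ := by norm_num
  linarith

/-- **The radial straightening of `B` realising the framing path `β`**: a `Straightening B`
(`GompfFramedTwistTransport.lean`) whose diffeotopy is the radial one, with linear parts
`G_t = β(1 - σ t) B⁻¹` on the cube `|vᵢ| < R`. [cite: GompfAGT2010, Def. 4.1 and §4 ¶2 (X^σ depends only on the straightening class σ)] -/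
def radialStraightening : Straightening B where
  D := radialTorusDiffeotopy B β
  based t := Diffeotopy.torusExtend_toFun_one _ _ _ t (radialLinMap_zero _ t)
  G t := β.reverseInv.toFun (Real.smoothTransition t)
  Ginv t := β.reverseInv.inv (Real.smoothTransition t)
  contDiff_G i j := (β.reverseInv.contDiff_apply i j).comp Real.smoothTransition.contDiff
  contDiff_Ginv i j := (β.reverseInv.contDiff_inv_apply i j).comp Real.smoothTransition.contDiff
  G_mul_Ginv t := β.reverseInv.mul_inv _
  Ginv_mul_G t := β.reverseInv.inv_mul _
  G_zero := by rw [Real.smoothTransition.zero, β.reverseInv.eq_one 0 le_rfl]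
  G_one := by rw [Real.smoothTransition.one, β.reverseInv.eq_self 1 le_rfl]
  R := radialR B β
  R_pos := radialR_pos B β
  toFun_expT t v hv := radialTorusDiffeotopy_toFun_expT B β t v fun i ↦ (hv i).trans_le (radialR_le B β)
  invFun_expT t v hv := by
    set w := mulVecE (β.reverseInv.inv (Real.smoothTransition t)) v with hw
    have hwv : (radialTorusDiffeotopy B β).toFun t (expT w) = expT v := by
      rw [radialTorusDiffeotopy_toFun_expT B β t w (abs_mulVecE_inv_lt B β _ v hv), hw,
        mulVecE_mulVecE, β.reverseInv.mul_inv, mulVecE_one]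
    rw [← hwv, Diffeotopy.invFun_toFun]

/-- The linear parts of the radial straightening (definitional). [folklore] -/
@[simp] theorem radialStraightening_G (t : ℝ) :
    (radialStraightening B β).G t = β.toFun (1 - Real.smoothTransition t) * slRealMatrix B⁻¹ := rfl

/-- The cube radius of the radial straightening (definitional). [folklore] -/
@[simp] theorem radialStraightening_R : (radialStraightening B β).R = radialR B β := rfl

/-- **The framing path of the radial straightening is a reparametrisation of `β`**:
`S.path θ = β(1 - σ(λ(θ/2)))`, `λ = isotopyProfile`. [cite: GompfAGT2010, Def. 4.1 and §4 ¶2 (X^σ depends only on the straightening class σ)] -/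
theorem radialStraightening_path_toFun (θ : ℝ) :
    (radialStraightening B β).path.toFun θ =
      β.toFun (1 - Real.smoothTransition (isotopyProfile (θ / 2))) := by
  change (radialStraightening B β).G (isotopyProfile (θ / 2)) * slRealMatrix B = _
  rw [radialStraightening_G, Matrix.mul_assoc, slRealMatrix_inv_mul, Matrix.mul_one]

/-- The time reparametrisation `θ ↦ 1 - σ(λ(θ/2))` as a self-map of the unit interval. [folklore] -/
def radialReparam (θ : I) : I :=
  ⟨1 - Real.smoothTransition (isotopyProfile (θ / 2)),
    by constructor <;> nlinarith [Real.smoothTransition.nonneg (isotopyProfile (θ / 2)),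
      Real.smoothTransition.le_one (isotopyProfile (θ / 2))]⟩

/-- The reparametrisation is continuous. [folklore] -/
theorem continuous_radialReparam : Continuous radialReparam :=
  Continuous.subtype_mk (continuous_const.sub (Real.smoothTransition.continuous.comp
    (contDiff_isotopyProfile.continuous.comp (continuous_subtype_val.div_const _)))) _

/-- The reparametrisation fixes `0` (`λ(0) = 1`, `σ(1) = 1`). [folklore] -/
theorem radialReparam_zero : radialReparam 0 = 0 := by
  apply Subtype.ext
  change 1 - Real.smoothTransition (isotopyProfile ((0 : ℝ) / 2)) = 0
  rw [zero_div, isotopyProfile_of_le (by norm_num), Real.smoothTransition.one, sub_self]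

/-- The reparametrisation fixes `1` (`λ(1/2) = 0`, `σ(0) = 0`). [folklore] -/
theorem radialReparam_one : radialReparam 1 = 1 := by
  apply Subtype.ext
  change 1 - Real.smoothTransition (isotopyProfile ((1 : ℝ) / 2)) = 1
  rw [isotopyProfile_of_ge (by norm_num), Real.smoothTransition.zero, sub_zero]

/-- **`β` is homotopic to the framing path of its radial straightening** (a reparametrisation). [cite: GompfAGT2010, Def. 4.1 and §4 ¶2 (X^σ depends only on the straightening class σ)] -/
theorem homotopic_radialStraightening_path :
    β.toPath.Homotopic (radialStraightening B β).path.toPath := by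
  have h : (radialStraightening B β).path.toPath =
      β.toPath.reparam radialReparam continuous_radialReparam radialReparam_zero radialReparam_one := by
    refine Path.ext (funext fun θ ↦ Subtype.ext ?_)
    change (radialStraightening B β).path.toFun θ = β.toFun (radialReparam θ)
    rw [radialStraightening_path_toFun]
    rfl
  rw [h]
  exact ⟨Path.Homotopy.reparam _ _ continuous_radialReparam radialReparam_zero radialReparam_one⟩

/-- **Every framed Cappell–Shaneson sphere is the product-framed surgery of its radially
straightened mapping torus**: `gompfSphere B β ≃ₘ (radialStraightening B β).prodSphere`, for every
`B ∈ SL(3, ℤ)` and every framing path `β` (no case distinction between the two straightening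
classes: the radial straightening realises `β` itself). Gompf 2010, §4 ¶2: "`X^{τ·σ}_ψ = X^σ_φ`",
via `Straightening.nonempty_diffeomorph_gompfSphere_prodSphere_of_homotopic`. [cite: GompfAGT2010, §4 ¶2 (X^{τ·σ}_ψ = X^σ_φ)] -/
theorem nonempty_diffeomorph_gompfSphere_radialProdSphere :
    Nonempty (gompfSphere B β ≃ₘ⟮𝓡 4, 𝓡 4⟯ (radialStraightening B β).prodSphere) :=
  (radialStraightening B β).nonempty_diffeomorph_gompfSphere_prodSphere_of_homotopic β
    (homotopic_radialStraightening_path B β)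

/-! ### The cone property of the radial straightening -/

/-- **The stages on rays**: for `θ u` in the open cube `|θ uⱼ| < π` (where `F_t` reads
`expT ∘ Φ_t ∘ logT`), `F_t (expT (θ u)) = expT (θ Q(σ(t) χ(θ u)) u)` with `Q(s) = β(1 - s) B⁻¹` —
every stage maps the ray of `u` into the cone swept by `Q(·) u`. [cite: GompfAGT2010, §4 ¶3 (each straightening keeps φ(α) within T)] -/
theorem radialStraightening_toFun_expT_smul (t θ : ℝ) (u : 𝔼 3) (hθu : ∀ j, |(θ • u) j| < π) :
    (radialStraightening B β).D.toFun t (expT (θ • u)) =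
      expT (θ • mulVecE (β.reverseInv.toFun
        (Real.smoothTransition t * logRadialCutoff (radialRho B β) (radialL B β) (θ • u))) u) := by
  change (radialTorusDiffeotopy B β).toFun t (expT (θ • u)) = _
  rw [radialTorusDiffeotopy, Diffeotopy.torusExtend_toFun_expT _ _ _ t hθu, radialDiffeotopy_toFun,
    radialLinMap_smul]

/-- **The straightened monodromy `ψ = B ∘ F₁` on rays**: for `θ u` in the open cube,
`ψ (expT (θ u)) = expT (θ • (B β(τ) B⁻¹) u)` with `τ = 1 - χ(θ u) ∈ [0, 1]` (`τ = 0` near the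
origin, `τ = 1` for `‖θ u‖ ≥ π/4`). With `u = B⁻¹ e` and `β` cone-nice for `B⁻¹ e`
(`SmoothMatrixPath.IsConeNice`, `exists_isConeNice_inv_e₁`) the right-hand side is
`expT (θ • (a(τ) e + b(τ) B e))`: the image of the coordinate circle in direction `e = e₁` is a
radial graph in the flat torus spanned by `e₁` and `B e₁ = e₃`, equal to the circle itself where
`b = 0` — Gompf's hypothesis "`T ⊃ α ∪ φ(α)` with `α ∩ φ(α)` connected" (§2, Thm 2.1) arranged as
in §4 ¶3. [cite: GompfAGT2010, §4 ¶3 (each straightening keeps φ(α) within T)] -/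
theorem radialStraightening_monodromy_expT_smul (θ : ℝ) (u : 𝔼 3) (hθu : ∀ j, |(θ • u) j| < π) :
    (radialStraightening B β).monodromy (expT (θ • u)) =
      expT (θ • mulVecE (slRealMatrix B *
        (β.toFun (1 - logRadialCutoff (radialRho B β) (radialL B β) (θ • u)) * slRealMatrix B⁻¹)) u) := by
  rw [Diffeomorph.coe_trans, Function.comp_apply, Diffeotopy.coe_stage, radialStraightening_toFun_expT_smul B β 1
    θ u hθu, Real.smoothTransition.one, one_mul, coe_torusDiffeomorph, torusMap_expT', ← mulVecE_smul,
    mulVecE_mulVecE, SmoothMatrixPath.reverseInv_toFun, mulVecE_smul]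

/-- `mulVecE` in terms of `*ᵥ` (Mathlib's `toLpLin_apply`). [folklore] -/
theorem mulVecE_eq_toLp (M : Matrix (Fin 3) (Fin 3) ℝ) (v : 𝔼 3) :
    mulVecE M v = WithLp.toLp 2 (M *ᵥ WithLp.ofLp v) := by
  rw [mulVecE_eq_toEuclideanLin]; rfl

/-- For `B` in Gompf's standard form, `B e₁ = e₃` over `ℝ`. [cite: GompfAGT2010, §3 (standard form)] -/
theorem slRealMatrix_mulVec_single_zero {B : Matrix.SpecialLinearGroup (Fin 3) ℤ}
    (hB : IsGompfStandardForm B) :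
    slRealMatrix B *ᵥ (Pi.single 0 1 : Fin 3 → ℝ) = Pi.single 2 1 := by
  obtain ⟨h00, h10, h20⟩ := hB
  rw [Matrix.mulVec_single_one]
  ext i
  fin_cases i <;> simp [slRealMatrix, h00, h10, h20]

/-- **Gompf's hypothesis `T ⊃ α ∪ ψ(α)` for the radially straightened monodromy of a cone-nice
framing path.** Let `B` be in standard form (`B e₁ = e₃`) and let the framing path `β` move
`u = B⁻¹ e₁` inside the cone of `u` and `B u = e₁`: `β(t) u = a(t) u + b(t) e₁`
(`SmoothMatrixPath.IsConeNice`, which `exists_isConeNice_inv_e₁` provides in every straightening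
class). Then the straightened monodromy `ψ = B ∘ F₁` of `radialStraightening B β` maps the point
`expT (θ e₁)` of the coordinate circle `α` (direction `e₁`, `|θ| < π`) to
`expT (θ (a(τ) e₁ + b(τ) e₃))`, `τ = 1 - χ(θ e₁)`: **`ψ(α)` is a radial graph inside the flat
coordinate torus `T` spanned by `e₁, e₃`**, coinciding with `α` exactly where `b(τ) = 0` (an
initial segment of radii, by cone-niceness) — Gompf, Thm 2.1: "a torus `T ⊂ M` containing both `α`
and `φ(α)` … with `α ∩ φ(α)` connected", arranged for the Cappell–Shaneson monodromy as in §4 ¶3. [cite: GompfAGT2010, §4 ¶3 (each straightening keeps φ(α) within T)] -/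
theorem radialStraightening_monodromy_expT_axis (hB : IsGompfStandardForm B) {a b : ℝ → ℝ}
    (hab : ∀ t, β.toFun t *ᵥ (slRealMatrix B⁻¹ *ᵥ (Pi.single 0 1 : Fin 3 → ℝ)) =
      a t • (slRealMatrix B⁻¹ *ᵥ Pi.single 0 1) +
        b t • (slRealMatrix B *ᵥ (slRealMatrix B⁻¹ *ᵥ Pi.single 0 1)))
    (θ : ℝ) (hθ : |θ| < π) :
    (radialStraightening B β).monodromy (expT (θ • EuclideanSpace.single 0 1)) =
      expT (θ • (a (1 - logRadialCutoff (radialRho B β) (radialL B β)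
          (θ • EuclideanSpace.single 0 1)) • EuclideanSpace.single 0 1 +
        b (1 - logRadialCutoff (radialRho B β) (radialL B β)
          (θ • EuclideanSpace.single 0 1)) • EuclideanSpace.single 2 1)) := by
  have hθu : ∀ j, |(θ • EuclideanSpace.single (0 : Fin 3) (1 : ℝ)) j| < π := by
    intro j
    fin_cases j <;> simp [hθ, Real.pi_pos]
  rw [radialStraightening_monodromy_expT_smul B β θ _ hθu]
  congr 2
  set τ := 1 - logRadialCutoff (radialRho B β) (radialL B β) (θ • EuclideanSpace.single (0 : Fin 3) (1 : ℝ))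
  have hBu : slRealMatrix B *ᵥ (slRealMatrix B⁻¹ *ᵥ (Pi.single 0 1 : Fin 3 → ℝ)) = Pi.single 0 1 := by
    rw [Matrix.mulVec_mulVec, slRealMatrix_mul_inv, Matrix.one_mulVec]
  rw [mulVecE_eq_toLp, PiLp.ofLp_single, ← Matrix.mulVec_mulVec, ← Matrix.mulVec_mulVec, hab τ,
    Matrix.mulVec_add, Matrix.mulVec_smul, Matrix.mulVec_smul, hBu, slRealMatrix_mulVec_single_zero hB,
    WithLp.toLp_add, WithLp.toLp_smul, WithLp.toLp_smul]
  rfl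

end Radial

end Literature.Topology.FourManifolds
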